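import Summits.AtomisticToContinuum.Crystallization.Theorems.PalmUnimodularRigidityLayeredLawsSelectHcpCertificateDefs
import Summits.AtomisticToContinuum.Crystallization.Theorems.PalmUnimodularRigidityLayeredLawsSelectHcpMeckeIntegral

/-!
# Crux `LayeredLawsSelectHcp` (stmt-AtomisticToContinuum-9226), line `mtp-prestress-split-ergodic-frame`:
# zero mean of a corrector from a Mecke transport function (the measure-theoretic assembly of `stub_correctorMeanZero`)

Registered sub-goal `tube_correctorMeanZero_of` of the crux item (lead c2, cycle 3).  The registered stub `stub_correctorMeanZero` (directed
orbit-sum correctors have zero mean under point-stationary hcp-layered laws) factors as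
(a) COMBINATORICS, pointwise on the sample: a jointly measurable transport function `g(μ, y)` whose SENT mass `∫ g(μ, y) dμ(y)` is
    `coef · Σ_{X ∈ rootedCharts μ} φ (reRoot X c)` and whose RECEIVED mass `∫ g(θ_y μ, −y) dμ(y)` is `coef · Σ_{X ∈ rootedCharts μ} φ X`
    almost surely (the bijection `(y, Ψ) ↦ reRoot Ψ c`, landed `tube_reRoot_involution` / `tube_reRoot_isRootedChart`, plus finiteness of
    the chart set, `tube_rootedCharts_ncard`), with finite double `‖·‖ₑ`-integral and integrable one-sided transports; and
(b) MEASURE THEORY, this file: from (a) the corrector is integrable with zero mean — the signed Mecke identity `tube_meckeIntegral`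
    (landed) equates the means of the sent and received masses.
[cite: LastPenrose2017, Theorem 9.4]
-/

noncomputable section

namespace Summit.AtomisticToContinuum.Crystallization.Theorems.PalmUnimodularRigidity.LayeredLawsSelectHcp

open MeasureTheory Set
open scoped ENNReal
open Summit.AtomisticToContinuum.Crystallization.Theorems.LayeredLawsSelectHcp.Negative.DiracLaws (PointStationary)

/-- **Registered sub-goal `tube_correctorMeanZero_of` — zero mean of a corrector from a transport function.**  Let `P` satisfy the crux's
Mecke identity and be a.s. locally finite; let `g` be a jointly measurable real transport function with finite double `‖·‖ₑ`-integral whose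
sent mass is a.s. `d.coef · ∑ᶠ_{X ∈ rootedCharts μ} d.φ (reRoot X d.shift)` and whose received mass is a.s.
`d.coef · ∑ᶠ_{X ∈ rootedCharts μ} d.φ X`, both `P`-integrable as functions of `μ`, and let the chart sets be a.s. finite.  Then
`corrector d` is `P`-integrable with `∫ corrector d dP = 0`. [cite: LastPenrose2017, Theorem 9.4] -/
theorem tube_correctorMeanZero_of :
    ∀ (d : CorrDatum) (P : Measure (Measure (EuclideanSpace ℝ (Fin 3)))), PointStationary P →
      (∀ᵐ μ ∂P, ∀ n : ℕ, μ ((fun z : (EuclideanSpace ℝ (Fin 3)) => ⌊‖z‖⌋₊) ⁻¹' {n}) < ⊤) →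
      (∀ᵐ μ ∂P, (rootedCharts μ).Finite) →
      ∀ g : Measure (EuclideanSpace ℝ (Fin 3)) → (EuclideanSpace ℝ (Fin 3)) → ℝ, Measurable (Function.uncurry g) →
        (∫⁻ μ, ∫⁻ y, ‖g μ y‖ₑ ∂μ ∂P ≠ ⊤) →
        (∀ᵐ μ ∂P, ∫ y, g μ y ∂μ = d.coef * ∑ᶠ X ∈ rootedCharts μ, d.φ (reRoot X d.shift)) →
        (∀ᵐ μ ∂P, ∫ y, g (Measure.map (fun z => z - y) μ) (-y) ∂μ = d.coef * ∑ᶠ X ∈ rootedCharts μ, d.φ X) →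
        Integrable (fun μ => ∫ y, g μ y ∂μ) P →
        Integrable (fun μ => ∫ y, g (Measure.map (fun z => z - y) μ) (-y) ∂μ) P →
          Integrable (corrector d) P ∧ ∫ μ, corrector d μ ∂P = 0 := by
  intro d P hstat hlf hfinRC g hg hfin hsend hrecv hint1 hint2
  -- pointwise, on the a.s. event where the chart set is finite, the corrector is the difference "sent − received"
  have hptw : ∀ᵐ μ ∂P, corrector d μ =
      (∫ y, g μ y ∂μ) - ∫ y, g (Measure.map (fun z => z - y) μ) (-y) ∂μ := by
    filter_upwards [hfinRC, hsend, hrecv] with μ hF hs hr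
    rw [hs, hr, corrector, ← mul_sub]
    congr 1
    rw [finsum_mem_sub_distrib _ _ hF]
  have hae : corrector d =ᵐ[P] fun μ => (∫ y, g μ y ∂μ) - ∫ y, g (Measure.map (fun z => z - y) μ) (-y) ∂μ := hptw
  have hint : Integrable (corrector d) P := (hint1.sub hint2).congr hae.symm
  refine ⟨hint, ?_⟩
  rw [integral_congr_ae hae, integral_sub hint1 hint2, tube_meckeIntegral P hstat hlf g hg hfin, sub_self]

end Summit.AtomisticToContinuum.Crystallization.Theorems.PalmUnimodularRigidity.LayeredLawsSelectHcp

end
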